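import Mathlib.LinearAlgebra.ExteriorPower.Basis
import Mathlib.LinearAlgebra.FiniteDimensional.Lemmas
import Mathlib.LinearAlgebra.Dimension.Constructions
import Mathlib.Algebra.Algebra.Bilinear
import Mathlib.RingTheory.TensorProduct.Finite
import HarnessLib

/-!
# Symmetric tensors as the kernel of the wedge `W ⊗ W → ⋀² W`, and the count `g(g+1)/2`

Generic linear algebra (textbook; [BourbakiAlgebraI1989, Ch. III §7 no. 4 Prop. 7 / §6 no. 3], [Lang2002, Ch. XIX §1
Prop. 1.1 and Ch. XVI §8]).  For a module `M` over a commutative ring `R`, the multiplication of the exterior algebra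
restricted to degree one,
`μ := LinearMap.mul' R (ExteriorAlgebra R M) ∘ₗ TensorProduct.map (ι R) (ι R) : M ⊗[R] M →ₗ[R] ExteriorAlgebra R M`,
`v ⊗ w ↦ v ∧ w`, has

* range the second exterior power `⋀[R]^2 M` (`range_mul'_comp_map_ι`);
* kernel EXACTLY the symmetric tensors `span R {v ⊗ v}` — in every characteristic, by the universal property of
  `⋀[R]^2 M` (`ker_mul'_comp_map_ι_eq_span_tmul_self`); when `2` is a unit this is also the fixed space of the flip
  `TensorProduct.comm` (`eqLocus_comm_eq_span_tmul_self`);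
* over a field `K` with `finrank K W = g`: `finrank (ker μ) = (g+1).choose 2 = g(g+1)/2`
  (`finrank_ker_mul'_comp_map_ι`, `…_eq_mul_div_two`), also after twisting the first factor by an isomorphism
  `φ : V ≃ₗ[K] W` (`finrank_ker_mul'_comp_map_ι_comp`, the shape `v ⊗ w ↦ φ(v) ∧ w : V ⊗ W → ⋀² W`).

Written with existing Mathlib terms only (no new definition): `LinearMap.mul'`, `ExteriorAlgebra.ι`,
`exteriorPower` (`⋀[R]^n M = LinearMap.range (ι R) ^ n`), `exteriorPower.alternatingMapLinearEquiv`,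
`exteriorPower.finrank_eq`, `TensorProduct.comm`, `LinearMap.eqLocus`.  Motivation (not used here): the tangent count
of the deformation space of a principally polarised abelian variety, `dim ker (v ⊗ w ↦ dλ(v) ∧ w :
Lie A ⊗ H¹(A,𝒪_A) → ∧² H¹(A,𝒪_A)) = g(g+1)/2` ([Oort1971, §2], [Sernesi2006, Thm. 3.3.11]).

## References
* [Bourbaki, Algèbre, Ch. III §7 no. 4]
* [Lang2002] S. Lang, *Algebra*, 3rd ed., GTM 211, Ch. XIX §1.
-/

open scoped TensorProduct
open Module ExteriorAlgebra

namespace Literature.LinearAlgebra.Alternating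

section CommRing

variable (R : Type*) [CommRing R] (M : Type*) [AddCommGroup M] [Module R M]

/-- The wedge `μ = mul' ∘ (ι ⊗ ι)` on a pure tensor: `μ (v ⊗ w) = ι v * ι w` (`= v ∧ w`).
[cite: Lang2002, Ch. XIX §1] -/
@[simp] theorem mul'_comp_map_ι_apply_tmul (v w : M) :
    (LinearMap.mul' R (ExteriorAlgebra R M) ∘ₗ TensorProduct.map (ι R) (ι R)) (v ⊗ₜ[R] w) = ι R v * ι R w := by
  simp

/-- The range of the wedge `M ⊗ M → ⋀ M` is the second exterior power `⋀[R]^2 M`.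
[cite: Lang2002, Ch. XIX §1, Prop. 1.1] -/
theorem range_mul'_comp_map_ι :
    LinearMap.range (LinearMap.mul' R (ExteriorAlgebra R M) ∘ₗ TensorProduct.map (ι R) (ι R)) = ⋀[R]^2 M := by
  rw [exteriorPower, pow_two, Submodule.mul_eq_map₂]
  apply le_antisymm
  · rintro _ ⟨t, rfl⟩
    induction t using TensorProduct.induction_on with
    | zero => simp
    | tmul v w =>
        simpa [LinearMap.mul'_apply] using
          Submodule.apply_mem_map₂ (LinearMap.mul R (ExteriorAlgebra R M)) (LinearMap.mem_range_self (ι R) v)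
            (LinearMap.mem_range_self (ι R) w)
    | add x y hx hy => simpa using add_mem hx hy
  · refine Submodule.map₂_le.mpr ?_
    rintro _ ⟨v, rfl⟩ _ ⟨w, rfl⟩
    exact ⟨v ⊗ₜ w, by simp⟩

/-- Every value of the wedge lies in `⋀[R]^2 M`. [cite: Lang2002, Ch. XIX §1] -/
theorem mul'_comp_map_ι_mem (t : M ⊗[R] M) :
    (LinearMap.mul' R (ExteriorAlgebra R M) ∘ₗ TensorProduct.map (ι R) (ι R)) t ∈ ⋀[R]^2 M :=
  range_mul'_comp_map_ι R M ▸ LinearMap.mem_range_self _ t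

/-- Squares `v ⊗ v` are killed by the wedge: `span R {v ⊗ v} ≤ ker μ` (`ι v * ι v = 0`).
[cite: Lang2002, Ch. XIX §1] -/
theorem span_tmul_self_le_ker_mul'_comp_map_ι :
    Submodule.span R (Set.range fun v : M => v ⊗ₜ[R] v) ≤
      LinearMap.ker (LinearMap.mul' R (ExteriorAlgebra R M) ∘ₗ TensorProduct.map (ι R) (ι R)) := by
  rw [Submodule.span_le]
  rintro _ ⟨v, rfl⟩
  simp

/-- **Kernel of the wedge = symmetric tensors**, in every characteristic:
`ker (v ⊗ w ↦ v ∧ w) = span R {v ⊗ v}`.  Proof: the bilinear map `(v, w) ↦ [v ⊗ w] mod span {u ⊗ u}` is alternating,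
so it factors through `⋀[R]^2 M` (`exteriorPower.alternatingMapLinearEquiv`); composing with the wedge gives the
quotient map, whence `ker μ ≤ span {u ⊗ u}`. [cite: Lang2002, Ch. XIX §1, Prop. 1.1]
[cite: BourbakiAlgebraI1989, Ch. III §7 no. 4 Prop. 7] -/
theorem ker_mul'_comp_map_ι_eq_span_tmul_self :
    LinearMap.ker (LinearMap.mul' R (ExteriorAlgebra R M) ∘ₗ TensorProduct.map (ι R) (ι R)) =
      Submodule.span R (Set.range fun v : M => v ⊗ₜ[R] v) := by
  classical
  refine le_antisymm ?_ (span_tmul_self_le_ker_mul'_comp_map_ι R M)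
  set μ := LinearMap.mul' R (ExteriorAlgebra R M) ∘ₗ TensorProduct.map (ι R) (ι R) with hμ
  set S := Submodule.span R (Set.range fun v : M => v ⊗ₜ[R] v) with hS
  -- the alternating bilinear map `(v, w) ↦ [v ⊗ w]`
  let F : MultilinearMap R (fun _ : Fin 2 => M) ((M ⊗[R] M) ⧸ S) :=
    MultilinearMap.mk' (fun m => S.mkQ (m 0 ⊗ₜ[R] m 1))
      (by intro m i x y; fin_cases i <;> simp [TensorProduct.add_tmul, TensorProduct.tmul_add])
      (by intro m i c x; fin_cases i <;> simp [← TensorProduct.smul_tmul', TensorProduct.tmul_smul])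
  have hF : ∀ m : Fin 2 → M, F m = S.mkQ (m 0 ⊗ₜ[R] m 1) := fun m => rfl
  let A : M [⋀^Fin 2]→ₗ[R] ((M ⊗[R] M) ⧸ S) :=
    { F with
      map_eq_zero_of_eq' := by
        intro m i j hij hne
        have h01 : m 0 = m 1 := by
          fin_cases i <;> fin_cases j
          · exact absurd rfl hne
          · exact hij
          · exact hij.symm
          · exact absurd rfl hne
        change F m = 0
        rw [hF, h01, Submodule.mkQ_apply, Submodule.Quotient.mk_eq_zero]
        exact Submodule.subset_span ⟨m 1, rfl⟩ }
  have hA : ∀ m : Fin 2 → M, A m = S.mkQ (m 0 ⊗ₜ[R] m 1) := fun m => rfl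
  let g : ⋀[R]^2 M →ₗ[R] ((M ⊗[R] M) ⧸ S) := exteriorPower.alternatingMapLinearEquiv A
  -- `g (v ∧ w) = [v ⊗ w]`
  have hg : ∀ v w : M, g (exteriorPower.ιMulti R 2 ![v, w]) = S.mkQ (v ⊗ₜ[R] w) := by
    intro v w
    simp only [g, exteriorPower.alternatingMapLinearEquiv_apply_ιMulti, hA]
    simp
  -- the wedge of a pure tensor, as an element of `⋀[R]^2 M`, is `ιMulti ![v, w]`
  have hwedge : ∀ v w : M,
      (⟨μ (v ⊗ₜ[R] w), mul'_comp_map_ι_mem R M _⟩ : ⋀[R]^2 M) = exteriorPower.ιMulti R 2 ![v, w] := by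
    intro v w
    apply Subtype.ext
    simp [hμ, exteriorPower.ιMulti_apply_coe, ExteriorAlgebra.ιMulti_apply]
  -- `g ∘ μ = mkQ`
  have hcomp : g ∘ₗ LinearMap.codRestrict (⋀[R]^2 M) μ (mul'_comp_map_ι_mem R M) = S.mkQ := by
    refine TensorProduct.ext' fun v w => ?_
    simp only [LinearMap.coe_comp, Function.comp_apply]
    have : LinearMap.codRestrict (⋀[R]^2 M) μ (mul'_comp_map_ι_mem R M) (v ⊗ₜ[R] w) =
        exteriorPower.ιMulti R 2 ![v, w] := by
      rw [← hwedge]; rfl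
    rw [this, hg]
  intro t ht
  have h0 : LinearMap.codRestrict (⋀[R]^2 M) μ (mul'_comp_map_ι_mem R M) t = 0 := by
    apply Subtype.ext
    simpa using LinearMap.mem_ker.mp ht
  have : S.mkQ t = 0 := by
    rw [← hcomp, LinearMap.coe_comp, Function.comp_apply, h0, map_zero]
  simpa [Submodule.Quotient.mk_eq_zero] using this

/-- `v ⊗ w + w ⊗ v` is a symmetric tensor: it lies in `span R {u ⊗ u}` (polarisation
`(v+w)⊗(v+w) − v⊗v − w⊗w`). [cite: BourbakiAlgebraI1989, Ch. III §6 no. 3] -/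
theorem tmul_add_tmul_comm_mem_span_tmul_self (v w : M) :
    v ⊗ₜ[R] w + w ⊗ₜ[R] v ∈ Submodule.span R (Set.range fun u : M => u ⊗ₜ[R] u) := by
  have h : v ⊗ₜ[R] w + w ⊗ₜ[R] v = (v + w) ⊗ₜ[R] (v + w) - v ⊗ₜ[R] v - w ⊗ₜ[R] w := by
    simp only [TensorProduct.add_tmul, TensorProduct.tmul_add]
    abel
  rw [h]
  exact sub_mem (sub_mem (Submodule.subset_span ⟨v + w, rfl⟩) (Submodule.subset_span ⟨v, rfl⟩))
    (Submodule.subset_span ⟨w, rfl⟩)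

/-- For every tensor `t`, its symmetrisation `t + flip t` is a symmetric tensor (`∈ span R {u ⊗ u}`).
[cite: BourbakiAlgebraI1989, Ch. III §6 no. 3] -/
theorem add_comm_apply_mem_span_tmul_self (t : M ⊗[R] M) :
    t + TensorProduct.comm R M M t ∈ Submodule.span R (Set.range fun u : M => u ⊗ₜ[R] u) := by
  induction t using TensorProduct.induction_on with
  | zero => simp
  | tmul v w => simpa using tmul_add_tmul_comm_mem_span_tmul_self R M v w
  | add x y hx hy =>
      have : x + y + TensorProduct.comm R M M (x + y) =
          (x + TensorProduct.comm R M M x) + (y + TensorProduct.comm R M M y) := by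
        simp only [map_add]; abel
      rw [this]
      exact add_mem hx hy

/-- Squares are fixed by the flip: `span R {u ⊗ u} ≤ {t | comm t = t}` (every characteristic).
[cite: BourbakiAlgebraI1989, Ch. III §6 no. 3] -/
theorem span_tmul_self_le_eqLocus_comm :
    Submodule.span R (Set.range fun u : M => u ⊗ₜ[R] u) ≤
      LinearMap.eqLocus (TensorProduct.comm R M M).toLinearMap LinearMap.id := by
  rw [Submodule.span_le]
  rintro _ ⟨u, rfl⟩
  simp [LinearMap.mem_eqLocus]

/-- When `2` is a unit, the flip-fixed tensors are exactly the span of the squares: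
`{t | comm t = t} = span R {u ⊗ u}` (`t = ½ (t + comm t)`). [cite: BourbakiAlgebraI1989, Ch. III §6 no. 3] -/
-- General form for FREE modules in every characteristic: `eqLocus_comm_eq_span_tmul_self_of_free` (§ Free below).
theorem eqLocus_comm_eq_span_tmul_self (h2 : IsUnit (2 : R)) :
    LinearMap.eqLocus (TensorProduct.comm R M M).toLinearMap LinearMap.id =
      Submodule.span R (Set.range fun u : M => u ⊗ₜ[R] u) := by
  refine le_antisymm ?_ (span_tmul_self_le_eqLocus_comm R M)
  intro t ht
  rw [LinearMap.mem_eqLocus] at ht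
  obtain ⟨u, hu⟩ := h2
  have key : t = (↑u⁻¹ : R) • (t + TensorProduct.comm R M M t) := by
    simp only [LinearEquiv.coe_coe, LinearMap.id_coe, id_eq] at ht
    rw [ht, ← two_smul R t, smul_smul, ← hu, Units.inv_mul, one_smul]
  rw [key]
  exact Submodule.smul_mem _ _ (add_comm_apply_mem_span_tmul_self R M t)

/-- When `2` is a unit: `ker (v ⊗ w ↦ v ∧ w) = {t | comm t = t}`, the symmetric tensors as a fixed space.
[cite: Lang2002, Ch. XIX §1, Prop. 1.1] [cite: BourbakiAlgebraI1989, Ch. III §7 no. 4 Prop. 7] -/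
theorem ker_mul'_comp_map_ι_eq_eqLocus_comm (h2 : IsUnit (2 : R)) :
    LinearMap.ker (LinearMap.mul' R (ExteriorAlgebra R M) ∘ₗ TensorProduct.map (ι R) (ι R)) =
      LinearMap.eqLocus (TensorProduct.comm R M M).toLinearMap LinearMap.id := by
  rw [ker_mul'_comp_map_ι_eq_span_tmul_self, eqLocus_comm_eq_span_tmul_self R M h2]

end CommRing

section Field

variable (K : Type*) [Field K] (W : Type*) [AddCommGroup W] [Module K W] [FiniteDimensional K W]

/-- Rank–nullity for the wedge over a field: `finrank (ker μ) + (finrank W).choose 2 = (finrank W)^2`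
(`range μ = ⋀[K]^2 W` has `finrank = g.choose 2`, `exteriorPower.finrank_eq`; `finrank (W ⊗ W) = g^2`).
[cite: Lang2002, Ch. XIX §1, Prop. 1.1] -/
theorem finrank_ker_mul'_comp_map_ι_add_choose :
    finrank K (LinearMap.ker (LinearMap.mul' K (ExteriorAlgebra K W) ∘ₗ TensorProduct.map (ι K) (ι K))) +
      (finrank K W).choose 2 = finrank K W ^ 2 := by
  have h := LinearMap.finrank_range_add_finrank_ker
    (LinearMap.mul' K (ExteriorAlgebra K W) ∘ₗ TensorProduct.map (ι K) (ι K))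
  rw [range_mul'_comp_map_ι, exteriorPower.finrank_eq, Module.finrank_tensorProduct] at h
  rw [sq]
  omega

/-- **The count `g(g+1)/2`**: over a field, `finrank (ker (v ⊗ w ↦ v ∧ w)) = (g+1).choose 2`, `g = finrank K W`
(the dimension of the symmetric tensors `Sym² W`). [cite: Lang2002, Ch. XVI §8; Ch. XIX §1] -/
theorem finrank_ker_mul'_comp_map_ι :
    finrank K (LinearMap.ker (LinearMap.mul' K (ExteriorAlgebra K W) ∘ₗ TensorProduct.map (ι K) (ι K))) =
      (finrank K W + 1).choose 2 := by
  have h := finrank_ker_mul'_comp_map_ι_add_choose K W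
  have h2 : (finrank K W + 1).choose 2 = finrank K W + (finrank K W).choose 2 := by
    rw [Nat.choose_succ_succ, Nat.choose_one_right]
  have h3 : (finrank K W + 1) * finrank K W = (finrank K W + 1).choose 2 * 2 := by
    simpa [Nat.choose_one_right] using Nat.add_one_mul_choose_eq (finrank K W) 1
  set d := finrank K W
  set k := finrank K (LinearMap.ker (LinearMap.mul' K (ExteriorAlgebra K W) ∘ₗ TensorProduct.map (ι K) (ι K)))
  have h4 : (d + 1) * d = d ^ 2 + d := by ring
  generalize d ^ 2 = e at h h4
  omega

/-- The same count in closed form: `finrank (ker (v ⊗ w ↦ v ∧ w)) = g(g+1)/2`, `g = finrank K W`.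
[cite: Lang2002, Ch. XVI §8] -/
theorem finrank_ker_mul'_comp_map_ι_eq_mul_div_two :
    finrank K (LinearMap.ker (LinearMap.mul' K (ExteriorAlgebra K W) ∘ₗ TensorProduct.map (ι K) (ι K))) =
      finrank K W * (finrank K W + 1) / 2 := by
  rw [finrank_ker_mul'_comp_map_ι, Nat.choose_two_right, Nat.add_sub_cancel, mul_comm]

/-- `finrank` of the symmetric tensors `span K {u ⊗ u} ⊆ W ⊗ W` is `(g+1).choose 2` (every characteristic).
[cite: BourbakiAlgebraI1989, Ch. III §6 no. 3] [cite: Lang2002, Ch. XVI §8] -/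
theorem finrank_span_tmul_self :
    finrank K (Submodule.span K (Set.range fun u : W => u ⊗ₜ[K] u)) = (finrank K W + 1).choose 2 := by
  rw [← ker_mul'_comp_map_ι_eq_span_tmul_self, finrank_ker_mul'_comp_map_ι]

/-- `finrank` of the flip-fixed tensors `{t ∈ W ⊗ W | comm t = t}` is `(g+1).choose 2` when `2 ≠ 0` in `K`.
[cite: BourbakiAlgebraI1989, Ch. III §6 no. 3] -/
theorem finrank_eqLocus_comm (h2 : (2 : K) ≠ 0) :
    finrank K (LinearMap.eqLocus (TensorProduct.comm K W W).toLinearMap LinearMap.id) =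
      (finrank K W + 1).choose 2 := by
  rw [eqLocus_comm_eq_span_tmul_self K W (Ne.isUnit h2), finrank_span_tmul_self]

/-- **Twisted form** (the shape `v ⊗ w ↦ φ(v) ∧ w : V ⊗ W → ⋀² W` for an isomorphism `φ : V ≃ W`):
`finrank (ker (mul' ∘ (ι ∘ φ) ⊗ ι)) = (g+1).choose 2`, `g = finrank K W` (precomposition with the isomorphism
`φ ⊗ id` does not change the kernel's dimension). [cite: Lang2002, Ch. XIX §1, Prop. 1.1] -/
theorem finrank_ker_mul'_comp_map_ι_comp {V : Type*} [AddCommGroup V] [Module K V] (φ : V ≃ₗ[K] W) :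
    finrank K (LinearMap.ker (LinearMap.mul' K (ExteriorAlgebra K W) ∘ₗ
        TensorProduct.map ((ι K) ∘ₗ φ.toLinearMap) (ι K))) = (finrank K W + 1).choose 2 := by
  have hfac : TensorProduct.map ((ι K) ∘ₗ φ.toLinearMap) (ι K : W →ₗ[K] ExteriorAlgebra K W) =
      TensorProduct.map (ι K) (ι K) ∘ₗ (TensorProduct.congr φ (LinearEquiv.refl K W)).toLinearMap := by
    refine TensorProduct.ext' fun v w => ?_
    simp
  rw [hfac, ← LinearMap.comp_assoc, LinearMap.ker_comp,
    (LinearEquiv.ofSubmodule' (TensorProduct.congr φ (LinearEquiv.refl K W)) _).finrank_eq,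
    finrank_ker_mul'_comp_map_ι]

/-- Twisted form, counted on the source: `finrank (ker (v ⊗ w ↦ φ(v) ∧ w)) = (finrank K V + 1).choose 2`.
[cite: Lang2002, Ch. XIX §1, Prop. 1.1] -/
theorem finrank_ker_mul'_comp_map_ι_comp' {V : Type*} [AddCommGroup V] [Module K V] (φ : V ≃ₗ[K] W) :
    finrank K (LinearMap.ker (LinearMap.mul' K (ExteriorAlgebra K W) ∘ₗ
        TensorProduct.map ((ι K) ∘ₗ φ.toLinearMap) (ι K))) = (finrank K V + 1).choose 2 := by
  rw [finrank_ker_mul'_comp_map_ι_comp, φ.finrank_eq]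

end Field

section Free

variable (R : Type*) [CommRing R] (M : Type*) [AddCommGroup M] [Module R M] [Module.Free R M]

/-- **Flip-fixed tensors = span of squares for FREE modules, in EVERY characteristic** (ed. 2; removes the `IsUnit 2`
hypothesis of `eqLocus_comm_eq_span_tmul_self` when `M` is free): `{t ∈ M ⊗ M | comm t = t} = span R {u ⊗ u}`.
Proof on a basis `b` with a linear order on its index: with `U`/`D`/`L` the strictly-upper / diagonal / strictly-lower
coordinate projections of `b ⊗ b`, `id = U + D + L` and `comm ∘ U ∘ comm = L`; so a flip-fixed `t` equals `(U + comm ∘ U + D) t`,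
and that operator takes values in `span {u ⊗ u}` (`b i ⊗ b j + b j ⊗ b i`, `b i ⊗ b i`).
[cite: BourbakiAlgebraI1989, Ch. III §6 no. 3] -/
theorem eqLocus_comm_eq_span_tmul_self_of_free :
    LinearMap.eqLocus (TensorProduct.comm R M M).toLinearMap LinearMap.id =
      Submodule.span R (Set.range fun u : M => u ⊗ₜ[R] u) := by
  classical
  refine le_antisymm ?_ (span_tmul_self_le_eqLocus_comm R M)
  letI : LinearOrder (Module.Free.ChooseBasisIndex R M) := linearOrderOfSTO WellOrderingRel
  set S := Submodule.span R (Set.range fun u : M => u ⊗ₜ[R] u) with hS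
  let b : Module.Basis (Module.Free.ChooseBasisIndex R M) R M := Module.Free.chooseBasis R M
  let bb := b.tensorProduct b
  let c : M ⊗[R] M →ₗ[R] M ⊗[R] M := (TensorProduct.comm R M M).toLinearMap
  let U : M ⊗[R] M →ₗ[R] M ⊗[R] M := bb.constr R fun p => if p.1 < p.2 then bb p else 0
  let D : M ⊗[R] M →ₗ[R] M ⊗[R] M := bb.constr R fun p => if p.1 = p.2 then bb p else 0
  let L : M ⊗[R] M →ₗ[R] M ⊗[R] M := bb.constr R fun p => if p.2 < p.1 then bb p else 0
  have hbb : ∀ p : Module.Free.ChooseBasisIndex R M × Module.Free.ChooseBasisIndex R M,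
      bb p = b p.1 ⊗ₜ[R] b p.2 := fun p => Module.Basis.tensorProduct_apply' b b p
  have hU : ∀ p, U (bb p) = if p.1 < p.2 then bb p else 0 := fun p => by
    simp only [U, Module.Basis.constr_basis]
  have hD : ∀ p, D (bb p) = if p.1 = p.2 then bb p else 0 := fun p => by
    simp only [D, Module.Basis.constr_basis]
  have hL : ∀ p, L (bb p) = if p.2 < p.1 then bb p else 0 := fun p => by
    simp only [L, Module.Basis.constr_basis]
  have hc : ∀ p : Module.Free.ChooseBasisIndex R M × Module.Free.ChooseBasisIndex R M,
      c (bb p) = bb (p.2, p.1) := by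
    intro p
    simp [c, hbb, TensorProduct.comm_tmul]
  -- (α) `U + D + L = id`
  have hsum : U + D + L = LinearMap.id := by
    refine bb.ext fun p => ?_
    simp only [LinearMap.add_apply, hU, hD, hL, LinearMap.id_coe, id_eq]
    rcases lt_trichotomy p.1 p.2 with (h : p.1 < p.2) | (h : p.1 = p.2) | (h : p.2 < p.1)
    · simp [h, ne_of_lt h, not_lt_of_gt h]
    · simp [h]
    · simp [h, (ne_of_lt h).symm, not_lt_of_gt h]
  -- (β) `c ∘ U ∘ c = L`
  have hcUc : c ∘ₗ U ∘ₗ c = L := by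
    refine bb.ext fun p => ?_
    obtain ⟨i, j⟩ := p
    simp only [LinearMap.coe_comp, Function.comp_apply, hc, hU, hL]
    split_ifs with h
    · exact hc (j, i)
    · simp
  -- (γ) the operator `P := U + c ∘ U + D` takes values in `S`
  have hP : ∀ p : Module.Free.ChooseBasisIndex R M × Module.Free.ChooseBasisIndex R M,
      (U + c ∘ₗ U + D) (bb p) ∈ S := by
    rintro ⟨i, j⟩
    simp only [LinearMap.add_apply, LinearMap.coe_comp, Function.comp_apply, hU, hD]
    by_cases hij : i < j
    · simp only [hij, if_true, ne_of_lt hij, if_false, add_zero, hc]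
      simp only [hbb]
      exact tmul_add_tmul_comm_mem_span_tmul_self R M (b i) (b j)
    · by_cases heq : i = j
      · subst heq
        simp only [lt_irrefl, if_false, map_zero, zero_add, if_true, hbb]
        exact Submodule.subset_span ⟨b i, rfl⟩
      · simp [hij, heq]
  have hrange : LinearMap.range (U + c ∘ₗ U + D) ≤ S := by
    rw [LinearMap.range_eq_map, ← bb.span_eq, Submodule.map_span, Submodule.span_le]
    rintro _ ⟨_, ⟨p, rfl⟩, rfl⟩
    exact hP p
  intro t ht
  have hct : c t = t := by simpa [c, LinearMap.mem_eqLocus] using ht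
  have h1 : t = U t + D t + L t := by
    simpa using (LinearMap.congr_fun hsum t).symm
  have h2 : L t = c (U (c t)) := by
    simpa using (LinearMap.congr_fun hcUc t).symm
  have key : t = (U + c ∘ₗ U + D) t := by
    simp only [LinearMap.add_apply, LinearMap.coe_comp, Function.comp_apply]
    calc t = U t + D t + L t := h1
      _ = U t + D t + c (U t) := by rw [h2, hct]
      _ = U t + c (U t) + D t := by abel
  rw [key]
  exact hrange (LinearMap.mem_range_self _ t)

/-- For free modules, in every characteristic: `ker (v ⊗ w ↦ v ∧ w) = {t | comm t = t}`.
[cite: Lang2002, Ch. XIX §1, Prop. 1.1] [cite: BourbakiAlgebraI1989, Ch. III §7 no. 4 Prop. 7] -/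
theorem ker_mul'_comp_map_ι_eq_eqLocus_comm_of_free :
    LinearMap.ker (LinearMap.mul' R (ExteriorAlgebra R M) ∘ₗ TensorProduct.map (ι R) (ι R)) =
      LinearMap.eqLocus (TensorProduct.comm R M M).toLinearMap LinearMap.id := by
  rw [ker_mul'_comp_map_ι_eq_span_tmul_self, eqLocus_comm_eq_span_tmul_self_of_free]

end Free

section FieldAnyChar

variable (K : Type*) [Field K] (W : Type*) [AddCommGroup W] [Module K W] [FiniteDimensional K W]

/-- `finrank` of the flip-fixed tensors `{t ∈ W ⊗ W | comm t = t}` is `(g+1).choose 2` over ANY field (no hypothesis on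
the characteristic; ed. 2). [cite: BourbakiAlgebraI1989, Ch. III §6 no. 3] -/
theorem finrank_eqLocus_comm' :
    finrank K (LinearMap.eqLocus (TensorProduct.comm K W W).toLinearMap LinearMap.id) =
      (finrank K W + 1).choose 2 := by
  rw [eqLocus_comm_eq_span_tmul_self_of_free, finrank_span_tmul_self]

end FieldAnyChar

end Literature.LinearAlgebra.Alternating
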